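import Mathlib.Data.ZMod.ValMinAbs
import Mathlib.Data.Int.Interval
import Mathlib.Algebra.BigOperators.Intervals
import Mathlib.Algebra.Order.Field.Rat
import Mathlib.Tactic.FieldSimp
import Mathlib.Tactic.Linarith
import Mathlib.Tactic.Ring
import HarnessLib

/-!
# [IUTchII] Remark 2.6.3 (ii): the quantity `‖Γ'‖` attached to a subgraph `Γ'` of `Γ_Ÿ` and its
# monotonicity (d)

S. Mochizuki, *Inter-universal Teichmüller theory II*, §2, Remark 2.6.3 (ii) (kurims Dec-2020
manuscript pp. 79–80) [cite: Mochizuki2012, Rmk 2.6.3 (ii) p.79]. Typed by abc-iut-L6-t2 (BLOCK B,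
plan/L6/ASSIGNMENTS.md §5 v1.4). Claim key DISPUTED (D-0012); what is proved here is elementary
arithmetic of the printed definition and takes no side.

**What is printed (p. 79–80).** With `Γ_Ÿ` "a copy of the real line `ℝ`" whose vertices are the
integers, for a [finite] subgraph `Γ'` — "by abuse of notation, let us write «`j̲ ∈ Γ'`» for vertices
`j̲ ∈ ℤ` that lie in `Γ'`" — "we shall be concerned with the issue of maximizing the quantity
`‖Γ'‖ := |Γ'|⁻¹ · Σ_{j ∈ F_l^⋇} min_{j̲ ∈ j ∩ Γ'} {j̲²}` — where we write `|Γ'|` for the cardinality of the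
image in `F_l^⋇` of the nonzero elements of `Γ'`; we regard the «min» over an empty set as being
equal to zero; we think of the various `j ∈ F_l^⋇` as corresponding to the subsets of `ℤ` determined
by the fibers of the natural projection `ℤ ↠ |F_l| (⊇ F_l^⋇)`"; and the observation "(d) the function
of `|Γ'|` constituted by `‖Γ'‖` — which may be thought of as a sort of average — is a monotone
increasing [but not strictly increasing!] function of `|Γ'|` valued in the positive rational numbers
which attains its maximum when `|Γ'| = l⋇` and is constant for `|Γ'| ≥ l⋇`", whence "there is «no loss
of generality» in assuming that `Γ' = Γ^▶_Ÿ`". Conditions (a) connected, (b) contains `0` of (i) mean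
`Γ'` is an integer interval `[-a, b]`, `a, b ≥ 0`.

**Dictionary.** `l` odd, `l⋇ = l / 2`; the projection `ℤ ↠ |F_l| = F_l/{±1}` is
`absLabel l z := |valMinAbs (z mod l)|` (Mathlib `ZMod.valMinAbs`), so the label of `j̲` is the
element `∈ {0, 1, …, l⋇}`; `Γ' : Finset ℤ`; the fiber over `j`, the «min» (zero on an empty fiber),
`|Γ'|` (`labelCount`) and `‖Γ'‖` (`subgraphNorm`, a rational number) are real definitions.

**Proved.** For `Γ' = [-a, b]` and `n := min (max a b) l⋇`: `|Γ'| = n`, the fiber-minimum over the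
label `j` is `j²` for `1 ≤ j ≤ n` and `0` beyond, hence `‖Γ'‖ = (Σ_{j=1}^{n} j²)/n = (n+1)(2n+1)/6`
(`subgraphNorm_interval`), which is increasing in `n`, maximal and then constant once
`max a b ≥ l⋇` — statement (d). The value at `Γ^▶_Ÿ` (`n = l⋇`), `(l⋇+1)(2l⋇+1)/6 = (l⋇+1)(l+1)/12`... is
recorded as `subgraphNorm_max`; it is the average `(1/l⋇) Σ_{j=1}^{l⋇} j²` of the weights `j²` of the
Gaussian monoids (cf. Remark 4.7.3 (iii), [IUTchIV] Thm 1.10 Step (v)).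
-/

namespace Literature.IUT.HodgeArakelov

open scoped BigOperators

namespace SubgraphNorm

/-- The projection `ℤ ↠ |F_l| = {0, 1, …, l⋇}`: the absolute value of the representative of least
absolute value of `z mod l` ("the natural projection `ℤ ↠ |F_l|`", [IUTchII] Rmk 2.6.3 (ii) p. 79).
[cite: Mochizuki2012, Rmk 2.6.3 (ii) p.79] -/
def absLabel (l : ℕ) (z : ℤ) : ℕ := ((z : ZMod l).valMinAbs).natAbs

variable {l : ℕ} [NeZero l]

/-- A label is at most `l⋇ = l/2`. [cite: Mochizuki2012, Rmk 2.6.3 (ii) p.79] -/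
theorem absLabel_le_half (z : ℤ) : absLabel l z ≤ l / 2 := ZMod.natAbs_valMinAbs_le _

/-- A label is at most the absolute value of any representative: `|j̲| ≥ j` for `j̲` in the fiber
over `j` (the representative of least absolute value). [cite: Mochizuki2012, Rmk 2.6.3 (ii) p.79] -/
theorem absLabel_le_natAbs (z : ℤ) : absLabel l z ≤ z.natAbs :=
  ZMod.natAbs_min_of_le_div_two l _ z (ZMod.coe_valMinAbs _) (ZMod.natAbs_valMinAbs_le _)

omit [NeZero l] in
/-- The label of `j ∈ {0, …, l⋇}` is `j`. [cite: Mochizuki2012, Rmk 2.6.3 (ii) p.79] -/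
theorem absLabel_natCast {j : ℕ} (hj : j ≤ l / 2) : absLabel l (j : ℤ) = j := by
  unfold absLabel
  rw [Int.cast_natCast, ZMod.valMinAbs_natCast_of_le_half hj, Int.natAbs_natCast]

omit [NeZero l] in
/-- Labels are invariant under `z ↦ -z` (`|F_l| = F_l/{±1}`). [cite: Mochizuki2012, Rmk 2.6.3 (ii) p.79] -/
theorem absLabel_neg (z : ℤ) : absLabel l (-z) = absLabel l z := by
  unfold absLabel
  rw [Int.cast_neg, ZMod.natAbs_valMinAbs_neg]

variable (l)

/-- The fiber `j ∩ Γ'` of `Γ' ⊆ ℤ` over the label `j` ([IUTchII] Rmk 2.6.3 (ii) p. 79).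
[cite: Mochizuki2012, Rmk 2.6.3 (ii) p.79] -/
def fiber (Γ : Finset ℤ) (j : ℕ) : Finset ℤ := Γ.filter fun z => absLabel l z = j

/-- `min_{j̲ ∈ j ∩ Γ'} {j̲²}`, "the «min» over an empty set … equal to zero" ([IUTchII] Rmk 2.6.3 (ii)
p. 79). [cite: Mochizuki2012, Rmk 2.6.3 (ii) p.79] -/
def fiberMinSq (Γ : Finset ℤ) (j : ℕ) : ℕ :=
  if h : (fiber l Γ j).Nonempty then ((fiber l Γ j).image fun z => z.natAbs ^ 2).min' (h.image _)
  else 0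

/-- `|Γ'|`: "the cardinality of the image in `F_l^⋇` of the nonzero elements of `Γ'`" = the number of
nonzero labels attained ([IUTchII] Rmk 2.6.3 (ii) p. 79). [cite: Mochizuki2012, Rmk 2.6.3 (ii) p.79] -/
def labelCount (Γ : Finset ℤ) : ℕ := ((Γ.image (absLabel l)).erase 0).card

/-- `‖Γ'‖ := |Γ'|⁻¹ · Σ_{j ∈ F_l^⋇} min_{j̲ ∈ j ∩ Γ'} {j̲²}` ([IUTchII] Rmk 2.6.3 (ii) p. 79), with
`F_l^⋇ = {1, …, l⋇}`, `l⋇ = l/2`. [cite: Mochizuki2012, Rmk 2.6.3 (ii) p.79] -/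
def subgraphNorm (Γ : Finset ℤ) : ℚ :=
  (∑ j ∈ Finset.Icc 1 (l / 2), (fiberMinSq l Γ j : ℚ)) / labelCount l Γ

/-! ### The interval case `Γ' = [-a, b]` (conditions (a), (b) of Remark 2.6.3 (i)) -/

/-- The subgraph `[-a, b] ⊆ Γ_Ÿ` — connected and containing the vertex `0` (Rmk 2.6.3 (i) (a),(b)).
[cite: Mochizuki2012, Rmk 2.6.3 (i) p.79] -/
def interval (a b : ℕ) : Finset ℤ := Finset.Icc (-(a : ℤ)) b

variable {l}

/-- Elements of `[-a, b]` have absolute value at most `max a b`. [cite: Mochizuki2012, Rmk 2.6.3 (ii) p.79] -/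
theorem natAbs_le_of_mem_interval {a b : ℕ} {z : ℤ} (hz : z ∈ interval a b) : z.natAbs ≤ max a b := by
  simp only [interval, Finset.mem_Icc] at hz
  omega

/-- `±j ∈ [-a, b]` for `1 ≤ j ≤ max a b`: a representative of label `j` of absolute value `j`.
[cite: Mochizuki2012, Rmk 2.6.3 (ii) p.79] -/
theorem exists_rep_mem_interval {a b j : ℕ} (hj : j ≤ max a b) :
    ∃ z : ℤ, z ∈ interval a b ∧ z.natAbs = j ∧ (z = j ∨ z = -j) := by
  by_cases hb : j ≤ b
  · exact ⟨j, by simp [interval]; omega, by simp, Or.inl rfl⟩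
  · have ha : j ≤ a := by omega
    exact ⟨-(j : ℤ), by simp [interval]; omega, by simp, Or.inr rfl⟩

/-- For `1 ≤ j ≤ min (max a b) l⋇` the fiber of `[-a,b]` over `j` is nonempty and its minimal square is
`j²`. [cite: Mochizuki2012, Rmk 2.6.3 (ii) p.79] -/
theorem fiberMinSq_interval_eq {a b j : ℕ} (hjm : j ≤ max a b) (hjl : j ≤ l / 2) :
    fiberMinSq l (interval a b) j = j ^ 2 := by
  obtain ⟨z, hz, hzabs, hzj⟩ := exists_rep_mem_interval (a := a) (b := b) hjm
  have hzlab : absLabel l z = j := by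
    rcases hzj with rfl | rfl
    · exact absLabel_natCast hjl
    · rw [absLabel_neg]; exact absLabel_natCast hjl
  have hzfib : z ∈ fiber l (interval a b) j := by
    simp only [fiber, Finset.mem_filter]; exact ⟨hz, hzlab⟩
  have hne : (fiber l (interval a b) j).Nonempty := ⟨z, hzfib⟩
  unfold fiberMinSq
  rw [dif_pos hne]
  apply le_antisymm
  · apply Finset.min'_le
    exact Finset.mem_image.mpr ⟨z, hzfib, by rw [hzabs]⟩
  · apply Finset.le_min'
    intro y hy
    obtain ⟨w, hw, rfl⟩ := Finset.mem_image.mp hy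
    simp only [fiber, Finset.mem_filter] at hw
    have := absLabel_le_natAbs (l := l) w
    rw [hw.2] at this
    exact Nat.pow_le_pow_left this 2

/-- For `max a b < j` the fiber of `[-a,b]` over `j` is empty, so its «min» is `0`.
[cite: Mochizuki2012, Rmk 2.6.3 (ii) p.79] -/
theorem fiberMinSq_interval_eq_zero {a b j : ℕ} (hj : max a b < j) :
    fiberMinSq l (interval a b) j = 0 := by
  have hempty : ¬ (fiber l (interval a b) j).Nonempty := by
    rintro ⟨z, hz⟩
    simp only [fiber, Finset.mem_filter] at hz
    have h1 := absLabel_le_natAbs (l := l) z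
    have h2 := natAbs_le_of_mem_interval hz.1
    rw [hz.2] at h1
    omega
  unfold fiberMinSq
  rw [dif_neg hempty]

/-- The nonzero labels attained by `[-a, b]` are exactly `{1, …, min (max a b) l⋇}`.
[cite: Mochizuki2012, Rmk 2.6.3 (ii) p.79] -/
theorem labels_interval (a b : ℕ) :
    ((interval a b).image (absLabel l)).erase 0 = Finset.Icc 1 (min (max a b) (l / 2)) := by
  ext j
  simp only [Finset.mem_erase, Finset.mem_image, Finset.mem_Icc]
  constructor
  · rintro ⟨hj0, z, hz, rfl⟩
    refine ⟨Nat.pos_of_ne_zero hj0, le_min ?_ (absLabel_le_half z)⟩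
    exact (absLabel_le_natAbs z).trans (natAbs_le_of_mem_interval hz)
  · rintro ⟨hj1, hj2⟩
    obtain ⟨z, hz, hzabs, hzj⟩ := exists_rep_mem_interval (a := a) (b := b) (hj2.trans (min_le_left _ _))
    have hjl : j ≤ l / 2 := hj2.trans (min_le_right _ _)
    refine ⟨by omega, z, hz, ?_⟩
    rcases hzj with rfl | rfl
    · exact absLabel_natCast hjl
    · rw [absLabel_neg]; exact absLabel_natCast hjl

/-- `|[-a, b]| = min (max a b) l⋇`. [cite: Mochizuki2012, Rmk 2.6.3 (ii) p.79] -/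
theorem labelCount_interval (a b : ℕ) : labelCount l (interval a b) = min (max a b) (l / 2) := by
  unfold labelCount
  rw [labels_interval, Nat.card_Icc]
  omega

/-- `Σ_{j=1}^{n} j² · 6 = n(n+1)(2n+1)`. [cite: Mochizuki2012, Rmk 2.6.3 (ii) p.80] -/
theorem sum_Icc_sq (n : ℕ) : (∑ j ∈ Finset.Icc 1 n, (j : ℚ) ^ 2) * 6 = n * (n + 1) * (2 * n + 1) := by
  induction n with
  | zero => simp
  | succ k ih =>
    rw [Finset.sum_Icc_succ_top (by omega), add_mul, ih]
    push_cast
    ring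

/-- The sum `Σ_{j ∈ F_l^⋇} min_{j̲ ∈ j ∩ Γ'} j̲²` for `Γ' = [-a, b]` equals `Σ_{j=1}^{n} j²`,
`n = min (max a b) l⋇`. [cite: Mochizuki2012, Rmk 2.6.3 (ii) p.80] -/
theorem sum_fiberMinSq_interval (a b : ℕ) :
    (∑ j ∈ Finset.Icc 1 (l / 2), (fiberMinSq l (interval a b) j : ℚ)) =
      ∑ j ∈ Finset.Icc 1 (min (max a b) (l / 2)), (j : ℚ) ^ 2 := by
  set n := min (max a b) (l / 2) with hn
  have hsplit : Finset.Icc 1 (l / 2) = Finset.Icc 1 n ∪ Finset.Ioc n (l / 2) := by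
    ext j; simp only [Finset.mem_union, Finset.mem_Icc, Finset.mem_Ioc]; omega
  have hdisj : Disjoint (Finset.Icc 1 n) (Finset.Ioc n (l / 2)) := by
    rw [Finset.disjoint_left]; intro j h1 h2
    simp only [Finset.mem_Icc, Finset.mem_Ioc] at h1 h2; omega
  rw [hsplit, Finset.sum_union hdisj]
  have h0 : ∑ j ∈ Finset.Ioc n (l / 2), (fiberMinSq l (interval a b) j : ℚ) = 0 := by
    apply Finset.sum_eq_zero
    intro j hj
    simp only [Finset.mem_Ioc] at hj
    have : max a b < j := by omega
    rw [fiberMinSq_interval_eq_zero this]; simp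
  rw [h0, add_zero]
  apply Finset.sum_congr rfl
  intro j hj
  simp only [Finset.mem_Icc] at hj
  rw [fiberMinSq_interval_eq (by omega) (by omega)]
  push_cast; ring

/-- **Remark 2.6.3 (ii) (d), computed** ([IUTchII] p. 80): for `Γ' = [-a, b]` with
`n := min (max a b) l⋇ ≥ 1`, `‖Γ'‖ = (n+1)(2n+1)/6` — a function of `|Γ'| = n` alone.
[cite: Mochizuki2012, Rmk 2.6.3 (ii) p.80] -/
theorem subgraphNorm_interval (a b : ℕ) (hn : 1 ≤ min (max a b) (l / 2)) :
    subgraphNorm l (interval a b) =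
      (((min (max a b) (l / 2) : ℕ) : ℚ) + 1) * (2 * ((min (max a b) (l / 2) : ℕ) : ℚ) + 1) / 6 := by
  unfold subgraphNorm
  rw [sum_fiberMinSq_interval, labelCount_interval]
  set n := min (max a b) (l / 2)
  have hsum := sum_Icc_sq n
  have hn' : (n : ℚ) ≠ 0 := by exact_mod_cast (by omega : n ≠ 0)
  field_simp
  linarith [hsum]

/-- The function `n ↦ (n+1)(2n+1)/6` of (d) is monotone increasing ("a monotone increasing …
function of `|Γ'|`", Rmk 2.6.3 (ii) (d) p. 80). [cite: Mochizuki2012, Rmk 2.6.3 (ii) p.80] -/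
theorem normValue_mono {m n : ℕ} (h : m ≤ n) :
    ((m : ℚ) + 1) * (2 * (m : ℚ) + 1) / 6 ≤ ((n : ℚ) + 1) * (2 * (n : ℚ) + 1) / 6 := by
  have : (m : ℚ) ≤ n := by exact_mod_cast h
  have hm : (0 : ℚ) ≤ m := by positivity
  nlinarith

/-- **(d), saturation**: once `max a b ≥ l⋇` (in particular for `Γ' ⊇ Γ^▶_Ÿ`), `|Γ'| = l⋇` and
`‖Γ'‖ = (l⋇+1)(2l⋇+1)/6` — "attains its maximum when `|Γ'| = l⋇` and is constant for `|Γ'| ≥ l⋇`"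
([IUTchII] Rmk 2.6.3 (ii) (d) p. 80); this is the average `(1/l⋇) Σ_{j=1}^{l⋇} j²` of the weights of the
Gaussian monoids. [cite: Mochizuki2012, Rmk 2.6.3 (ii) p.80] -/
theorem subgraphNorm_max (a b : ℕ) (hl : 1 ≤ l / 2) (hab : l / 2 ≤ max a b) :
    labelCount l (interval a b) = l / 2 ∧
      subgraphNorm l (interval a b) = (((l / 2 : ℕ) : ℚ) + 1) * (2 * ((l / 2 : ℕ) : ℚ) + 1) / 6 := by
  have hmin : min (max a b) (l / 2) = l / 2 := min_eq_right hab
  refine ⟨by rw [labelCount_interval, hmin], ?_⟩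
  rw [subgraphNorm_interval a b (by omega), hmin]

/-- **(d), monotonicity in the subgraph**: enlarging the interval can only increase `‖Γ'‖`
([IUTchII] Rmk 2.6.3 (ii) (d) p. 80). [cite: Mochizuki2012, Rmk 2.6.3 (ii) p.80] -/
theorem subgraphNorm_interval_mono {a b a' b' : ℕ} (ha : a ≤ a') (hb : b ≤ b')
    (hn : 1 ≤ min (max a b) (l / 2)) :
    subgraphNorm l (interval a b) ≤ subgraphNorm l (interval a' b') := by
  have hn' : 1 ≤ min (max a' b') (l / 2) := le_trans hn (by
    apply min_le_min_right; exact max_le_max ha hb)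
  rw [subgraphNorm_interval a b hn, subgraphNorm_interval a' b' hn']
  apply normValue_mono
  apply min_le_min_right
  exact max_le_max ha hb

end SubgraphNorm

end Literature.IUT.HodgeArakelov
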